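import Literature.Analysis.FluidPDE.NSLerayHopfProofs
import Literature.Analysis.FluidPDE.KatoLocalL3L5
import Literature.Analysis.FluidPDE.KatoLerayHopf
import HarnessLib

/-!
# Discharge of `ess_kato_L3_local` (Escauriaza–Seregin–Šverák 2003, Thm. 7.4 with Remark 7.5)

Analysis/FluidPDE proof file (theorems only), sibling of `NSLerayHopfProofs.lean`, where the named
fact `Literature.Analysis.FluidPDE.ess_kato_L3_local` is vendored (ESS 2003, Appendix, Thm. 7.4
with Remark 7.5 = Kato's `L³` local theory in the form used in §3 of the paper: for `ν > 0` and a
datum `a ∈ L₃ ∩ J̊` — square integrable, weakly divergence free, in `L³` — there are `T > 0` and a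
Leray–Hopf weak solution `u` of the unforced Cauchy problem on `[0, T)` with datum `a` which is
continuous into `L³` on `[0, T]` and lies in `L⁵(0,T; L⁵) ∩ L⁴(0,T; L⁴)`). This file **proves** it:

* Kato's mild solution with the weighted bound `√t‖u(t)‖_∞ ≤ C` and the space–time integrability
  `u ∈ L⁵(0, T₁; L⁵)` (`exists_isKatoSolutionOn_memLqLp_five`, `KatoLocalL3L5.lean`: the tree's
  Picard construction of Kato 1984, Thm. 1, plus Giga's estimate for the free heat flow through the
  maximal function, the `L⁵` Oseen–Duhamel bound, and an `L⁵` absorption lemma for the resulting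
  Volterra inequality — ESS (7.31), `L₅(Q_T)`);
* the Leray–Hopf property and `u ∈ L⁴(0,T; L⁴)` for square-integrable data
  (`IsKatoSolutionOn.isLerayHopfOn_of_memLp_two`, `KatoLerayHopf.lean`: the weak formulation with
  datum by the cut-off argument of `KatoWeakDatum.lean`, the energy class and the a.e. energy
  equality by Galdi's theorem `galdi_energy_equality_holds`, upgraded to every time by the
  `L³`-continuity, weak `L²`-continuity by density — ESS Remark 7.5, "`u` is in fact the weak
  Leray–Hopf solution"; Kato 1984, Thm. 4);
* `u ∈ C([0,T]; L³)` from `u ∈ C([0,T₁); L³)` with `T = T₁/2`.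

The printed proof (ESS §7, (7.35)–(7.43): successive approximations in `L₅ ∩ L₄(Q_T)` resting on
the energy-class theory of the Stokes system with `div f` forcing, Thm. 7.3) is thus replaced by
Kato's semigroup construction and Galdi's a posteriori energy-class theorem; the statement proved
is exactly the vendored one. Nothing else is declared here.

## References

* L. Escauriaza, G. Seregin, V. Šverák, *`L_{3,∞}`-solutions of Navier–Stokes equations and
  backward uniqueness*, Russ. Math. Surveys 58:2 (2003) 211–250 (= IMA preprint 1904, 2002),
  Appendix §7: Lemma 7.1, Thm. 7.3, Thm. 7.4 (7.28)–(7.34), proof (7.35)–(7.43), Remark 7.5.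
  [EscauriazaSereginSverak2003]
* T. Kato, Math. Z. 187 (1984) 471–480, Thms. 1, 4. [Kato1984]
* Y. Giga, J. Differential Equations 62 (1986) 186–212. [Giga1986]
* G. P. Galdi, Proc. AMS 147 (2019), Thm. 1.1. [Galdi2018]
-/

noncomputable section

open MeasureTheory Set Filter

namespace Literature.Analysis.FluidPDE

/-- **Discharge of `ess_kato_L3_local`** (Escauriaza–Seregin–Šverák 2003, Thm. 7.4 with
Remark 7.5; Kato 1984): for `ν > 0` and `a ∈ L² ∩ L³` weakly divergence free, Kato's solution on
`[0, T₁)` (`exists_isKatoSolutionOn_memLqLp_five`: mild, `C([0,T₁); L³)`, `√t‖u‖_∞ ≤ C`,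
`u ∈ L⁵(0,T₁; L⁵)`) is, on `[0, T)` with `T = T₁/2`, a Leray–Hopf weak solution with datum `a`
lying in `L⁴(0,T; L⁴)` (`IsKatoSolutionOn.isLerayHopfOn_of_memLp_two`), continuous into `L³` on
`[0, T]`, and in `L⁵(0,T; L⁵)`. [cite: EscauriazaSereginSverak2003, Thm. 7.4, Remark 7.5] -/
theorem ess_kato_L3_local_holds : ess_kato_L3_local := by
  intro ν hν a h₂ h₃ hdiv
  obtain ⟨T₁, hT₁, u, hK, ⟨C, hC⟩, h5⟩ := exists_isKatoSolutionOn_memLqLp_five hν h₃ hdiv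
  have hT : 0 < T₁ / 2 := half_pos hT₁
  have hTT₁ : T₁ / 2 < T₁ := half_lt_self hT₁
  obtain ⟨hLH, h4⟩ := hK.isLerayHopfOn_of_memLp_two hν h₂ hC hTT₁ hT
  exact ⟨T₁ / 2, hT, u, hLH, hK.continuousInLpOn.mono (Icc_subset_Ico_right hTT₁),
    h5.mono_set (Ioo_subset_Ioo_right hTT₁.le), h4⟩

end Literature.Analysis.FluidPDE
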